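import Literature.AlgebraicGeometry.Motives.LineSweptSurfaces
import Literature.AlgebraicGeometry.Motives.CubicThreePlaneSectionPlanes
import Mathlib.RingTheory.AlgebraicIndependent.Transcendental
import HarnessLib

/-!
# Planes of `X` are line-swept; families of lines over an abstract curve

R. Mboro, *Remarks on the `CH₂` of cubic hypersurfaces* (arXiv:1701.04488), proof of Thm. 1.3
(p. 8): "Finally, `𝒫` is in `Im(P_*)`" — the class of a plane `𝒫 ⊆ X` is the value of the
universal-line correspondence `P_* : CH₁(F(X)) → CH₂(X)` on a line of `F(X)` (the pencil of lines
of `𝒫` through a point). In the tree's rendering of `Im(P_*)` by LINE-SWEPT points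
(`ProjFamily.IsLineSweptPoint`, `Motives/LineSweptSurfaces`) this is the statement

* `ProjFamily.IsLinearSubspacePoint.isLineSweptPoint` — **every `2`-plane point of a closed
  `X ⊆ ℙᵈ⁺¹_k` (`d ≥ 1`) is line-swept**, whence
  `ProjFamily.closure_linearSubspaceClasses_le_closure_lineSweptClasses` — `⟨planes⟩ ≤ ⟨line-swept⟩`
  in `CH₂(X)`.

The family of lines is taken over an ABSTRACT regular proper curve `B` with function field `K`
(`ProjFamily.exists_regularProperCurve`: the normalisation of a line of `ℙ²_k`; any would do): for
`τ ∈ K` transcendental over `k` (`trdeg_k K = 1`) and a frame `(w₀, w₁, w₂)` of the plane, the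
`K`-line `span_K(w₀, w₁ + τ w₂)` lies in the plane, and a form `G` over `k` vanishes on it iff it
vanishes on the plane (`eval_add_smul_eq_zero_of_transcendental`: `G(A + τ C) = 0` forces
`G(A + t C) = 0` for all `t ∈ k`; then `G · λ` vanishes on the plane for a linear form `λ ∉ 𝔭_𝒫`,
and `𝔭_𝒫` is prime). The general tool is `ProjFamily.exists_point_of_fibre_line`: a `K`-line of
`ℙᵈ⁺¹_K` whose `k`-specialisation `π(ℓ)` (`π : ℙᵈ⁺¹_K → ℙᵈ⁺¹_k`) lies on `X` is a `K`-line of the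
generic fibre `X_K` of `X ×ₖ B → B`, and the point of `X` under `π(ℓ)` is line-swept as soon as it
has dimension `2` (used again for quadric surfaces in `Motives/LineSweptQuadricSurfaces`).
Everything is proved; no named facts.

## References

* [Mboro2018] R. Mboro, Remarks on the CH₂ of cubic hypersurfaces, arXiv:1701.04488, §1 (p. 6,
  `P_*`) and proof of Thm. 1.3 (p. 8, "`𝒫` is in `Im(P_*)`").
* [Hartshorne1977] R. Hartshorne, Algebraic Geometry (1977), I Ex. 2.11 (linear varieties).
-/

noncomputable section

open CategoryTheory CategoryTheory.Limits AlgebraicGeometry MonoidalCategory MvPolynomial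
  TopologicalSpace Order Topology
open Literature.AlgebraicGeometry.Motives.Segre Literature.AlgebraicGeometry.Motives.RatFn

universe u

namespace Literature.AlgebraicGeometry.Motives

attribute [local instance] MvPolynomial.gradedAlgebra MvPolynomial.algebraMvPolynomial
  Literature.AlgebraicGeometry.Motives.ProjBaseChange.algebraBase
  UniversalHyperplaneSection.sectionsAlgebra ProjFamily.functionFieldAlgebra

namespace ProjFamily

open ProjBaseChangeRing ProjectiveSpaceCells ProjectiveSpace ProjSpace
  Literature.RingTheory.MvPolynomial

variable {k : Type u} [Field k]

/-! ### Specialising a transcendental parameter -/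

section Transcendental

variable {K : Type*} [Field K] [Algebra k K]

/-- `p(T) = G(A + T C)` evaluates at `x` to `G(A + x C)`. [folklore] -/
theorem aeval_lineSubst {L : Type*} [CommRing L] [Algebra k L] {n : ℕ} (G : MvPolynomial (Fin n) k)
    (A C : Fin n → k) (x : L) :
    Polynomial.aeval x (aeval (fun j => Polynomial.C (A j) + Polynomial.X * Polynomial.C (C j)) G) =
      aeval (fun j => algebraMap k L (A j) + x * algebraMap k L (C j)) G := by
  change (Polynomial.aeval x).comp (aeval _) G = _
  rw [MvPolynomial.comp_aeval]
  have h : (fun j => Polynomial.aeval x (Polynomial.C (A j) + Polynomial.X * Polynomial.C (C j))) =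
      fun j => algebraMap k L (A j) + x * algebraMap k L (C j) := by
    funext j
    rw [map_add, map_mul, Polynomial.aeval_C, Polynomial.aeval_C, Polynomial.aeval_X, mul_comm]
  rw [h]

/-- **`G(A + τ C) = 0` for `τ` transcendental over `k` forces `G(A + t C) = 0` for every `t ∈ k`**:
the one-variable polynomial `G(A + T C) ∈ k[T]` has the transcendental root `τ`, hence vanishes.
[folklore] -/
theorem eval_add_smul_eq_zero_of_transcendental {τ : K} (hτ : Transcendental k τ) {n : ℕ}
    (G : MvPolynomial (Fin n) k) (A C : Fin n → k)
    (h : eval (fun j => algebraMap k K (A j) + τ * algebraMap k K (C j))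
      (MvPolynomial.map (algebraMap k K) G) = 0) (t : k) :
    eval (A + t • C) G = 0 := by
  -- the polynomial `p(T) = G(A + T C)`
  set p : Polynomial k :=
    aeval (fun j => Polynomial.C (A j) + Polynomial.X * Polynomial.C (C j)) G with hp
  have hpτ : Polynomial.aeval τ p = 0 := by
    rw [hp, aeval_lineSubst, ← h, MvPolynomial.eval_map, ← MvPolynomial.aeval_def]
  have hp0 : p = 0 := (transcendental_iff_injective.mp hτ) (by rw [hpτ, map_zero])
  have ht : Polynomial.aeval t p = eval (A + t • C) G := by
    rw [hp, aeval_lineSubst, show aeval (fun j => algebraMap k k (A j) + t * algebraMap k k (C j)) G =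
      eval (fun j => algebraMap k k (A j) + t * algebraMap k k (C j)) G from
        congrFun (MvPolynomial.aeval_eq_eval (f := _)) G]
    congr 1
  rw [← ht, hp0, map_zero]

end Transcendental

/-! ### A `K`-line whose specialisation lies on `X` gives a line-swept point -/

section Core

variable {d : ℕ} (X : SchemeOver k) (i : X ⟶ projectiveSpace (d + 1) k)
  (B : SchemeOver k) [IsIntegral B.left] [IsProper B.hom]

/-- **Families of lines over an abstract curve.** Let `B` be an integral proper `k`-curve with
`trdeg_k k(B) = 1` and principal stalks at closed points, `K = k(B)`, and `ℓ = V₊(μ) ⊆ ℙᵈ⁺¹_K` a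
`K`-line (given by `d` independent linear forms) whose image `π(ℓ)` under `π : ℙᵈ⁺¹_K → ℙᵈ⁺¹_k`
lies on `X`. Then `ℓ` is a `K`-line of the generic fibre `X_K` of `X ×ₖ B → B`, and the point
`y ∈ X` with `i y = π(ℓ)` — the generic point of the surface swept out by the family — is LINE-SWEPT
as soon as it has dimension `2`. [cite: Mboro2018, §1 (p. 6)] -/
theorem exists_point_of_fibre_line (hB1 : height (genericPoint B.left) = 1)
    (htr : Algebra.trdeg k B.left.functionField = 1)
    (hpid : ∀ b : B.left, IsClosed ({b} : Set B.left) →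
      IsPrincipalIdealRing (B.left.presheaf.stalk b))
    (μ : Fin (d + 1 - 1) → MvPolynomial (Fin (d + 1 + 1)) B.left.functionField)
    (hμli : LinearIndependent B.left.functionField μ) (hμhom : ∀ l, (μ l).IsHomogeneous 1)
    (hmem : projMap (d := d + 1) k B.left.functionField
      (linearSubspacePoint μ hμli hμhom (Nat.sub_le (d + 1) 1)) ∈ Set.range i.left.base) :
    ∃ y : ↥X.left, i.left.base y = projMap (d := d + 1) k B.left.functionField
        (linearSubspacePoint μ hμli hμhom (Nat.sub_le (d + 1) 1)) ∧
      (height y = 2 → IsLineSweptPoint i y) := by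
  set lam := linearSubspacePoint μ hμli hμhom (Nat.sub_le (d + 1) 1) with hlam
  -- `ℓ` lies in `X_K`
  have hrg : lam ∈ Set.range (iK (d + 1) B X i).base := by
    rw [range_iK, Set.mem_preimage, range_whiskerRight_left, Set.mem_preimage,
      fst_genericFibreι_apply (d + 1) B lam]
    exact hmem
  obtain ⟨x, hx⟩ := hrg
  -- the point of `X` under `π(ℓ)`
  have hfst : i.left.base ((CartesianMonoidalCategory.fst X B).left.base ((ιX B X).base x)) =
      projMap (d := d + 1) k B.left.functionField lam := by
    have h1 : i.left.base ((CartesianMonoidalCategory.fst X B).left.base ((ιX B X).base x)) =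
        (CartesianMonoidalCategory.fst (projectiveSpace (d + 1) k) B).left.base
          ((i ▷ B).left.base ((ιX B X).base x)) := by
      change ((CartesianMonoidalCategory.fst X B).left ≫ i.left).base ((ιX B X).base x) =
        ((i ▷ B).left ≫ (CartesianMonoidalCategory.fst (projectiveSpace (d + 1) k) B).left).base
          ((ιX B X).base x)
      rw [whiskerRight_left_fst]
    have h2 : (i ▷ B).left.base ((ιX B X).base x) = (genericFibreι (d + 1) B).base
        ((iK (d + 1) B X i).base x) := by
      change (ιX B X ≫ (i ▷ B).left).base x = (iK (d + 1) B X i ≫ genericFibreι (d + 1) B).base x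
      rw [iK_genericFibreι]
    rw [h1, h2, hx]
    exact fst_genericFibreι_apply (d + 1) B lam
  refine ⟨(CartesianMonoidalCategory.fst X B).left.base ((ιX B X).base x), hfst, fun hy2 => ?_⟩
  -- `x` lies over a line point
  have hxline : IsLinearSubspacePoint 1 (d + 1)
      (𝟙 (projectiveSpace (d + 1) B.left.functionField)) ((iK (d + 1) B X i).base x) := by
    rw [hx]
    have h := isLinearSubspacePoint_of_toIdeal_eq_span μ hμli hμhom (Nat.sub_le (d + 1) 1)
      (toIdeal_linearSubspacePoint μ hμli hμhom (Nat.sub_le (d + 1) 1))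
    rwa [show d + 1 - (d + 1 - 1) = 1 by omega] at h
  exact ⟨hy2, B, inferInstance, inferInstance, hB1, htr, hpid, x, hxline, rfl⟩

end Core

/-! ### A regular proper curve over `k` -/

section Curve

variable (k)

/-- **There is an integral proper curve over `k` with `trdeg_k = 1` and principal closed stalks**
(e.g. the normalisation of a line of `ℙ²_k`). [folklore] -/
theorem exists_regularProperCurve :
    ∃ (B : SchemeOver k) (_ : IsIntegral B.left) (_ : IsProper B.hom),
      height (genericPoint B.left) = 1 ∧ Algebra.trdeg k B.left.functionField = 1 ∧
      ∀ b : B.left, IsClosed ({b} : Set B.left) → IsPrincipalIdealRing (B.left.presheaf.stalk b) := by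
  haveI : IsProper (projectiveSpace 2 k).hom := isProper_projectiveSpace 2 k
  haveI : LocallyOfFiniteType (projectiveSpace 2 k).hom := inferInstance
  -- the line `V₊(x₀) ⊆ ℙ²`
  let L : Fin (2 - 1) → MvPolynomial (Fin (2 + 1)) k := fun _ => MvPolynomial.X 0
  have hL : LinearIndependent k L := by
    haveI : Unique (Fin (2 - 1)) := ⟨⟨⟨0, by norm_num⟩⟩, fun j => Fin.ext (by have := j.2; omega)⟩
    exact linearIndependent_unique_iff.mpr (MvPolynomial.X_ne_zero _)
  have hhom : ∀ j, (L j).IsHomogeneous 1 := fun _ => MvPolynomial.isHomogeneous_X k 0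
  let b₀ := linearSubspacePoint L hL hhom (Nat.sub_le 2 1)
  have hb₀ : height b₀ = 1 := height_linearSubspacePoint_of_line (by norm_num) L hL hhom
  refine ⟨curveB (projectiveSpace 2 k) b₀, inferInstance, isProper_curveB _ _,
    height_genericPoint_curveB hb₀, trdeg_curveB hb₀, fun b _ => isPrincipalIdealRing_stalk_curveB hb₀ b⟩

variable {k}

/-- A `k`-algebra of transcendence degree `1` has a transcendental element. [folklore] -/
theorem exists_transcendental_of_trdeg_eq_one {K : Type u} [Field K] [Algebra k K]
    (htr : Algebra.trdeg k K = 1) : ∃ τ : K, Transcendental k τ := by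
  have h : Algebra.Transcendental k K :=
    (trdeg_ne_zero_iff (R := k) (A := K)).mp (by rw [htr]; exact one_ne_zero)
  exact h.transcendental

end Curve

/-! ### Planes are line-swept -/

section Planes

variable {d : ℕ} {X : SchemeOver k} {i : X ⟶ projectiveSpace (d + 1) k} [IsClosedImmersion i.left]

/-- Linear forms over `K` evaluate `K`-linearly. [folklore] -/
theorem eval_add_smul_smul_of_isHomogeneous_one {K : Type*} [Field K] {n : ℕ}
    {L : MvPolynomial (Fin (n + 1)) K} (hL : L.IsHomogeneous 1) (s t : K) (x y : Fin (n + 1) → K) :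
    eval (s • x + t • y) L = s * eval x L + t * eval y L := by
  obtain ⟨φ, hφ⟩ := exists_linearMap_forall_eval_eq hL
  simp only [hφ, map_add, map_smul, smul_eq_mul]

/-- `(G ⊗ 1)(ι ∘ w) = ι (G(w))` for the scalar extension `ι : k → K`. [folklore] -/
theorem eval_map_algebraMap_comp {K : Type*} [CommRing K] [Algebra k K] {n : ℕ}
    (G : MvPolynomial (Fin n) k) (w : Fin n → k) :
    eval (fun j => algebraMap k K (w j)) (MvPolynomial.map (algebraMap k K) G) =
      algebraMap k K (eval w G) := by
  rw [MvPolynomial.eval_map, show eval w G = eval₂ (RingHom.id k) w G from rfl,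
    MvPolynomial.eval₂_comp_left]
  rfl

variable [Infinite k]

/-- **Planes are line-swept.** Every `2`-plane point `y` of a closed `X ⊆ ℙᵈ⁺¹_k` (`d ≥ 1`,
`k` infinite) is line-swept: for a frame `(w₀, w₁, w₂)` of the plane, a regular proper curve `B`
with function field `K` and `τ ∈ K` transcendental over `k`, the `K`-line `span_K(w₀, w₁ + τ w₂)`
lies in the plane and specialises to its generic point — a form over `k` vanishing on the line
vanishes on the plane. This is "`𝒫` is in `Im(P_*)`" of Mboro's proof of Thm. 1.3 (the pencil of
lines of the plane). [cite: Mboro2018, proof of Thm. 1.3 (arXiv:1701.04488, p. 8)] -/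
theorem IsLinearSubspacePoint.isLineSweptPoint (hd : 1 ≤ d) {y : ↥X.left}
    (hy : IsLinearSubspacePoint 2 (d + 1) i y) : IsLineSweptPoint i y := by
  classical
  obtain ⟨hy2, L, hL, hhom, hcl⟩ := hy
  -- `i y` is the generic point of the plane `V₊(L)`
  have ht : d + 1 - 2 ≤ d + 1 := Nat.sub_le _ _
  have hiy : i.left.base y = linearSubspacePoint L hL hhom ht := by
    refine eq_linearSubspacePoint_of_closure_eq L hL hhom ht ?_
    rw [← hcl, ← Set.image_singleton, i.left.isClosedEmbedding.closure_image_eq]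
  have hideal : (ProjectiveSpectrum.asHomogeneousIdeal
      (𝒜 := homogeneousSubmodule (Fin (d + 1 + 1)) k) (i.left.base y)).toIdeal =
        Ideal.span (Set.range L) := by
    rw [hiy]; exact toIdeal_linearSubspacePoint L hL hhom ht
  have hprime : (Ideal.span (Set.range L)).IsPrime := by
    rw [← hideal]
    exact (i.left.base y).isPrime
  -- a frame `w` of the plane
  obtain ⟨w', hw', hw'L⟩ := exists_frame_of_linearIndependent_linearForms L hL hhom
  have h3 : d + 1 + 1 - (d + 1 - 2) = 3 := by omega
  let w : Fin 3 → Fin (d + 1 + 1) → k := fun a => w' (a.cast h3.symm)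
  have hw : LinearIndependent k w := hw'.comp _ (Fin.cast_injective h3.symm)
  have hwL : ∀ j a, eval (w a) (L j) = 0 := fun j a => hw'L j _
  have hLspan : ∀ j, ∀ v ∈ Submodule.span k (Set.range w), eval v (L j) = 0 := fun j =>
    forall_mem_span_eval_eq_zero_of_isHomogeneous_one (hhom j) (by
      rintro _ ⟨a, rfl⟩; exact hwL j a)
  -- the ideal property of `L` on `span w`
  have hLideal : ∀ G : MvPolynomial (Fin (d + 1 + 1)) k,
      (∀ v ∈ Submodule.span k (Set.range w), eval v G = 0) → G ∈ Ideal.span (Set.range L) :=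
    fun G hG => mem_idealSpan_of_forall_mem_span_eval_eq_zero hw hL hhom hLspan (by omega) hG
  have hLvan : ∀ G ∈ Ideal.span (Set.range L), ∀ v ∈ Submodule.span k (Set.range w), eval v G = 0 :=
    fun G hG v hv => eval_eq_zero_of_mem_idealSpan_of_forall (fun j => hLspan j v hv) hG
  -- a linear form `λ₁` vanishing on `w₀, w₂` but not at `w₁`
  have h1 : w 1 ∉ Submodule.span k (Set.range ![w 0, w 2]) := by
    have h := hw.notMem_span_image (s := {0, 2}) (x := 1) (by decide)
    convert h using 2
    ext v
    simp [Set.image_insert_eq, Set.image_singleton, Matrix.range_cons, Matrix.range_empty,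
      Set.union_singleton, Set.pair_comm]
  have h02 : LinearIndependent k ![w 0, w 2] := by
    have h := hw.comp ![(0 : Fin 3), 2] (by decide)
    convert h using 1
    funext a; fin_cases a <;> rfl
  obtain ⟨lam₁, hlam₁hom, hlam₁van, hlam₁w⟩ := exists_linearForm_vanishing_eval_ne_zero h02 h1
  have hlam₁0 : eval (w 0) lam₁ = 0 := hlam₁van _ (Submodule.subset_span ⟨0, rfl⟩)
  have hlam₁2 : eval (w 2) lam₁ = 0 := hlam₁van _ (Submodule.subset_span ⟨1, rfl⟩)
  -- the curve `B`, `K = k(B)`, `τ` transcendental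
  obtain ⟨B, _, _, hB1, htr, hpid⟩ := exists_regularProperCurve k
  set K := B.left.functionField with hK
  obtain ⟨τ, hτ⟩ := exists_transcendental_of_trdeg_eq_one htr
  haveI : Infinite K := Infinite.of_injective (algebraMap k K) (algebraMap k K).injective
  let ι := algebraMap k K
  -- the `K`-line `span_K(w₀, w₁ + τ w₂)`
  set v0 : Fin (d + 1 + 1) → K := fun j => ι (w 0 j) with hv0
  set v1 : Fin (d + 1 + 1) → K := fun j => ι (w 1 j) + τ * ι (w 2 j) with hv1
  have hv1' : v1 = (1 : K) • (fun j => ι (w 1 j)) + τ • (fun j => ι (w 2 j)) := by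
    funext j; simp [hv1, Pi.add_apply, Pi.smul_apply, smul_eq_mul]
  let v : Fin 2 → Fin (d + 1 + 1) → K := ![v0, v1]
  have hvK : ∀ a, v a ∈ Submodule.span K (Set.range fun b j => ι (w b j)) := by
    intro a
    fin_cases a
    · exact Submodule.subset_span ⟨0, rfl⟩
    · change v1 ∈ _
      rw [hv1']
      exact Submodule.add_mem _ (Submodule.smul_mem _ _ (Submodule.subset_span ⟨1, rfl⟩))
        (Submodule.smul_mem _ _ (Submodule.subset_span ⟨2, rfl⟩))
  -- `v₀, v₁` are independent (test against `λ₀ ⊗ 1`, `λ₁ ⊗ 1`)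
  have hv : LinearIndependent K v := by
    have h12 : LinearIndependent k ![w 1, w 2] := by
      have h := hw.comp ![(1 : Fin 3), 2] (by decide)
      convert h using 1
      funext a; fin_cases a <;> rfl
    have h0 : w 0 ∉ Submodule.span k (Set.range ![w 1, w 2]) := by
      have h := hw.notMem_span_image (s := {1, 2}) (x := 0) (by decide)
      convert h using 2
      ext u
      simp [Set.image_insert_eq, Set.image_singleton, Matrix.range_cons, Matrix.range_empty,
        Set.union_singleton, Set.pair_comm]
    obtain ⟨lam₀, hlam₀hom, hlam₀van, hlam₀w⟩ := exists_linearForm_vanishing_eval_ne_zero h12 h0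
    have hlam₀1 : eval (w 1) lam₀ = 0 := hlam₀van _ (Submodule.subset_span ⟨0, rfl⟩)
    have hlam₀2 : eval (w 2) lam₀ = 0 := hlam₀van _ (Submodule.subset_span ⟨1, rfl⟩)
    obtain ⟨φ₀, hφ₀⟩ := exists_linearMap_forall_eval_eq (hlam₀hom.map ι)
    obtain ⟨φ₁, hφ₁⟩ := exists_linearMap_forall_eval_eq (hlam₁hom.map ι)
    have e0 : φ₀ v0 = ι (eval (w 0) lam₀) := by rw [← hφ₀]; exact eval_map_algebraMap_comp _ _
    have e0' : φ₀ v1 = 0 := by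
      rw [hv1', map_add, map_smul, map_smul, ← hφ₀, ← hφ₀, eval_map_algebraMap_comp,
        eval_map_algebraMap_comp, hlam₀1, hlam₀2, map_zero, smul_zero, smul_zero, add_zero]
    have e1 : φ₁ v0 = 0 := by
      rw [← hφ₁, hv0, eval_map_algebraMap_comp, hlam₁0, map_zero]
    have e1' : φ₁ v1 = ι (eval (w 1) lam₁) := by
      rw [hv1', map_add, map_smul, map_smul, ← hφ₁, ← hφ₁, eval_map_algebraMap_comp,
        eval_map_algebraMap_comp, hlam₁2, map_zero, smul_zero, add_zero, one_smul]
    refine LinearIndependent.pair_iff.2 fun s t hst => ?_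
    have hs : s = 0 := by
      have h := congrArg φ₀ hst
      rw [map_add, map_smul, map_smul, e0, e0', smul_zero, add_zero, map_zero, smul_eq_mul] at h
      rcases mul_eq_zero.1 h with h | h
      · exact h
      · exact absurd ((map_eq_zero_iff ι ι.injective).1 h) hlam₀w
    have ht' : t = 0 := by
      have h := congrArg φ₁ hst
      rw [map_add, map_smul, map_smul, e1, e1', smul_zero, zero_add, map_zero, smul_eq_mul] at h
      rcases mul_eq_zero.1 h with h | h
      · exact h
      · exact absurd ((map_eq_zero_iff ι ι.injective).1 h) hlam₁w
    exact ⟨hs, ht'⟩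
  obtain ⟨μ, hμli, hμhom, hμv, hμideal⟩ := exists_lineForms v hv (by omega : 1 ≤ d + 1)
  set lam := linearSubspacePoint μ hμli hμhom (Nat.sub_le (d + 1) 1) with hlamdef
  -- the key computation: `π(ℓ) = i y`, i.e. `G ⊗ 1 ∈ (μ) ↔ G ∈ (L)`
  have hkey : ∀ G : MvPolynomial (Fin (d + 1 + 1)) k,
      MvPolynomial.map ι G ∈ Ideal.span (Set.range μ) ↔ G ∈ Ideal.span (Set.range L) := by
    intro G
    constructor
    · intro hG
      -- `G ⊗ 1` vanishes on the `K`-line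
      have hGv : ∀ s t : K, eval (s • v 0 + t • v 1) (MvPolynomial.map ι G) = 0 := by
        intro s t
        refine eval_eq_zero_of_mem_idealSpan_of_forall (fun l => ?_) hG
        rw [eval_add_smul_smul_of_isHomogeneous_one (hμhom l), hμv l 0, hμv l 1, mul_zero,
          mul_zero, add_zero]
      -- hence `G(s₀ w₀ + t₀ w₁ + t₁ t₀ w₂) = 0` for all `s₀, t₀, t₁ ∈ k`
      have hG3 : ∀ s₀ t₀ t₁ : k, eval (s₀ • w 0 + t₀ • w 1 + (t₁ * t₀) • w 2) G = 0 := by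
        intro s₀ t₀ t₁
        have h := hGv (ι s₀) (ι t₀)
        have hpt : (ι s₀ • v 0 + ι t₀ • v 1) = fun j =>
            ι ((s₀ • w 0 + t₀ • w 1) j) + τ * ι ((t₀ • w 2) j) := by
          funext j
          change ι s₀ * ι (w 0 j) + ι t₀ * (ι (w 1 j) + τ * ι (w 2 j)) = _
          simp only [Pi.add_apply, Pi.smul_apply, smul_eq_mul, map_add, map_mul]
          ring
        rw [hpt] at h
        have h' := eval_add_smul_eq_zero_of_transcendental hτ G _ _ h t₁
        have hpt' : (s₀ • w 0 + t₀ • w 1) + t₁ • (t₀ • w 2) =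
            s₀ • w 0 + t₀ • w 1 + (t₁ * t₀) • w 2 := by
          rw [smul_smul]
        rwa [hpt'] at h'
      -- so `G λ₁` vanishes on the plane
      have hGlam : ∀ u ∈ Submodule.span k (Set.range w), eval u (G * lam₁) = 0 := by
        intro u hu
        obtain ⟨c, rfl⟩ := (Submodule.mem_span_range_iff_exists_fun k).1 hu
        rw [map_mul]
        by_cases hc : c 1 = 0
        · have hmem : (∑ a, c a • w a) ∈ Submodule.span k (Set.range ![w 0, w 2]) := by
            rw [Fin.sum_univ_three, hc, zero_smul, add_zero]
            exact Submodule.add_mem _ (Submodule.smul_mem _ _ (Submodule.subset_span ⟨0, rfl⟩))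
              (Submodule.smul_mem _ _ (Submodule.subset_span ⟨1, rfl⟩))
          rw [hlam₁van _ hmem, mul_zero]
        · have h := hG3 (c 0) (c 1) (c 2 / c 1)
          rw [div_mul_cancel₀ _ hc] at h
          rw [Fin.sum_univ_three, h, zero_mul]
      have hmem := hLideal _ hGlam
      rcases hprime.mem_or_mem hmem with h | h
      · exact h
      · exact absurd (hLvan _ h _ (Submodule.subset_span ⟨1, rfl⟩)) hlam₁w
    · intro hG
      -- `G ∈ (L)`, and every `L_j ⊗ 1` lies in `(μ)`
      have hLμ : ∀ j, MvPolynomial.map ι (L j) ∈ Ideal.span (Set.range μ) := by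
        intro j
        refine hμideal _ fun s t => ?_
        have hzero : ∀ u ∈ Submodule.span K (Set.range fun b j' => ι (w b j')),
            eval u (MvPolynomial.map ι (L j)) = 0 :=
          forall_mem_span_eval_eq_zero_of_isHomogeneous_one ((hhom j).map _) (by
            rintro _ ⟨b, rfl⟩
            rw [eval_map_algebraMap_comp, hwL j b, map_zero])
        exact hzero _ (Submodule.add_mem _ (Submodule.smul_mem _ _ (hvK 0))
          (Submodule.smul_mem _ _ (hvK 1)))
      have hmap : Ideal.map (MvPolynomial.map ι) (Ideal.span (Set.range L)) ≤ Ideal.span (Set.range μ) := by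
        rw [Ideal.map_span, Ideal.span_le]
        rintro _ ⟨_, ⟨j, rfl⟩, rfl⟩
        exact hLμ j
      exact hmap (Ideal.mem_map_of_mem _ hG)
  have hproj : projMap (d := d + 1) k K lam = i.left.base y := by
    refine ProjectiveSpectrum.ext (HomogeneousIdeal.toIdeal_injective ?_)
    rw [hideal]
    ext G
    rw [HomogeneousIdeal.mem_iff, mem_asHomogeneousIdeal_projMap_iff, ← hkey G,
      ← HomogeneousIdeal.mem_iff, toIdeal_linearSubspacePoint μ hμli hμhom]
  obtain ⟨y', hy', hls⟩ := exists_point_of_fibre_line X i B hB1 htr hpid μ hμli hμhom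
    (by rw [hproj]; exact ⟨y, rfl⟩)
  have hyy' : y' = y := i.left.isClosedEmbedding.injective (hy'.trans hproj)
  subst hyy'
  exact hls hy2

/-- **`⟨planes⟩ ≤ ⟨line-swept surfaces⟩` in `CH₂(X)`** for a closed `X ⊆ ℙᵈ⁺¹_k`, `d ≥ 1`, `k`
infinite. [cite: Mboro2018, proof of Thm. 1.3 (arXiv:1701.04488, p. 8)] -/
theorem closure_linearSubspaceClasses_le_closure_lineSweptClasses (hd : 1 ≤ d) :
    AddSubgroup.closure (linearSubspaceClasses 2 (d + 1) i) ≤ AddSubgroup.closure (lineSweptClasses i) := by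
  refine (AddSubgroup.closure_le _).2 ?_
  rintro _ ⟨y, hy, rfl⟩
  exact AddSubgroup.subset_closure ⟨y, IsLinearSubspacePoint.isLineSweptPoint hd hy, rfl⟩

end Planes

end ProjFamily

end Literature.AlgebraicGeometry.Motives
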